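import Summits.CriticalPhenomena.SAWScalingLimit.Theorems.SAWTotalPositivityCriticalBubbleBoundKestenHWCut
import Summits.CriticalPhenomena.SAWScalingLimit.Theorems.SAWTotalPositivityCriticalBubbleBoundKestenHWProduct
import Summits.CriticalPhenomena.SAWScalingLimit.Theorems.SAWTotalPositivityCriticalBubbleBoundKestenHWDivergence
import Summits.CriticalPhenomena.SAWScalingLimit.Theorems.SAWTotalPositivityCriticalBubbleBoundKestenHWBridgeSeriesTop
import Summits.CriticalPhenomena.SAWScalingLimit.Theorems.SAWTotalPositivityCriticalBubbleBoundKestenHWIdentity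
import Summits.CriticalPhenomena.SAWScalingLimit.Theorems.SAWTotalPositivityCriticalBubbleBoundKestenHWSpanLength
import Summits.CriticalPhenomena.SAWScalingLimit.Theorems.SAWTotalPositivityCriticalBubbleBoundKestenHWPinnedExp

/-!
# Line `kesten-product-renewal-dictionary` for the crux `SAWTotalPositivity.CriticalBubbleBound`
(stmt-CriticalPhenomena-7117): KESTEN'S CRITICALITY IDENTITY, the critical Hammersley–Welsh product
bound, the divergence of the bridge series at `x_c`, and the EFFECTIVE floor under stub B1

Assembly of the c4 programme (lead c4; the seven inputs H1–H7 landed as their own files, namespace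
`…Theorems.CriticalBubbleBound.Kesten.HW`):

* H1 `hw_cut` (`…KestenHWCut.lean`): the one-step Hammersley–Welsh cut of a self-avoiding half-space word
  at the last maximum of its first coordinate (bridge head of maximal span, reflected half-space tail of
  smaller width; injective);
* H2 `hw_product_bound` (`…KestenHWProduct.lean`): from H1, the product bound
  `Σ_{half-space SAW words, |w| ≤ N, max ≤ h} x^{|w|} ≤ Π_{a=1}^{h} (1 + B_{a,N}(x))`, `B_{a,N}(x)` the
  `x`-mass of self-avoiding bridge words of span `a` and length `≤ N` — Madras–Slade (3.1.2)–(3.1.4) in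
  GENERATING-FUNCTION form (the tree previously had only the counting form `h_n ≤ e^{3√n} b_n`);
* H3 `bridgeWordSeries_unbounded` (`…KestenHWDivergence.lean`): from H2 with `c_n ≤ Σ_m h_{m+1} h_{n-m}`
  and `c_n ≥ μⁿ`, the bridge generating function is unbounded as `x ↑ x_c` (Madras–Slade Cor. 3.1.8);
* H4 `bridgeSeries_eq_top_of_unbounded` (`…KestenHWBridgeSeriesTop.lean`): hence `Σ_n b_n x_c^n = ⊤`
  and `Σ_h u_h = ⊤` in the line's objects;
* H5 `kestenIdentity_of_unbounded` (`…KestenHWIdentity.lean`): hence KESTEN'S IDENTITY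
  `Σ_{β irreducible bridge} x_c^{|β|} = 1` (Kesten 1963 §4; Madras–Slade (4.2.4)) — renewal inequality
  `B_N(x) ≤ 1 + A·B_N(x)` plus the Kraft half `A ≤ 1` already in the tree;
* H6 `spanLengthWordMass_le` (`…KestenHWSpanLength.lean`) and H7 `pinnedLengthMass_le_exp_of`
  (`…KestenHWPinnedExp.lean`): from the product bound at `x = x_c` with Kesten's `B_a(x_c) ≤ 1`, the
  EFFECTIVE bounds `Λ_h := Σ_{span W = h} |W| x_c^{|W|} ≤ 2μ·4^h`, `sup_{v₀ = h} L(v) ≤ 2μ·4^h`,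
  `F(h) ≤ 4μ·4^h` (marked-step splitting of a bridge into a half-space prefix and a reversed suffix).

Here (all sorry-free, unconditional): `hw_product` (H2 ∘ H1), `halfSpaceWordMass_le_two_pow` (the
critical half-space word mass of width `≤ h` is `≤ 2^h`), `bridgeWordSeries_unbounded_holds` (H3 ∘ H2 ∘ H1),
`bridgeSeries_criticalFugacity_eq_top` and `tsum_columnMass_eq_top` (H4), **`kestenIdentity`** (H5 — verbatim
the statement of the support item `KestenIdentity`, stmt-CriticalPhenomena-4733, of the sister route
`SAWRenewalTightness`), `spanLengthWordMass_le_exp` (H6), `spanLengthMass_le_exp`, `pinnedLengthMass_le_exp`,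
`freePairMass_le_exp` (H7).

What this changes for the line: (i) "Kesten's renewal measure" (the lever of the dictionary: i.i.d.
irreducible bridges drawn with probability `x_c^{|β|}`) is now a theorem of the tree — the masses sum to
exactly `1`; (ii) the renewal walk renews infinitely often in mass (`Σ_h u_h = ∞`), so no decay exponent
`b > 1` for `u_h` can ever enter the trade-off line `a − b − c < −1` of `Cut.bubble_ne_top_of_exponents`;
(iii) B1's floor is now EFFECTIVE: `sup_{v₀ = h} L(v) ≤ 2μ·4^h` (c3's bound from the strip gap was a
tower in `h`). What it does NOT change: B1 `PinnedLengthMassBound (1/5)` asks for `(h+1)^{1/5}` (any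
polynomial bound would be new mathematics: a quantitative strip gap), and the two-walk stub C
`DisjointnessGain (5/4)` is untouched; the crux stays exactly as open as before (Madras–Slade p. 37).

Sources: H. Kesten, *J. Math. Phys.* 4 (1963) 960–969, §4; N. Madras, G. Slade, *The Self-Avoiding Walk*
(1993), §3.1 (Prop. 3.1.5, Cor. 3.1.8), §4.2 ((4.2.1)–(4.2.12)).
-/

noncomputable section

open Literature.Probability.LatticeModels
open Literature.Probability.RandomPlanarGeometry Literature.Probability.RandomPlanarGeometry.SAW
open scoped ENNReal NNReal BigOperators
open Classical

namespace Summit.CriticalPhenomena.SAWScalingLimit.Theorems.CriticalBubbleBound.Kesten.HW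

/-! ## The critical Hammersley–Welsh product bound (H2 ∘ H1) -/

/-- **The Hammersley–Welsh product bound**, unconditional: for every `x ≥ 0`, `N` and `h`, the `x`-mass of
the self-avoiding half-space words of length `≤ N` whose first coordinate stays `≤ h` is at most
`Π_{a=1}^{h} (1 + B_{a,N}(x))`, `B_{a,N}(x)` the `x`-mass of the self-avoiding bridge words of span `a` and length
`≤ N` (every half-space walk is a concatenation of bridges of strictly decreasing spans; Madras–Slade
(3.1.2)–(3.1.4), here in generating-function form). `hw_product_bound` applied to `hw_cut`.
[cite: MadrasSlade1993, §3.1, eq. (3.1.2)–(3.1.4)] -/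
theorem hw_product : ∀ x : ℝ, 0 ≤ x → ∀ N h : ℕ, (∑ w ∈ (Finset.range (N + 1)).biUnion (fun n => (sawWords n).filter (fun w => Zd.IsHalfSpace w.length (traj w) ∧ Zd.maxLevel w.length (traj w) ≤ (h : ℤ))), x ^ w.length) ≤ ∏ a ∈ Finset.Icc 1 h, (1 + ∑ w ∈ (Finset.range (N + 1)).biUnion (fun n => (sawWords n).filter (fun w => IsBridgeW w ∧ xEnd w = (a : ℤ))), x ^ w.length) :=
  hw_product_bound hw_cut

/-- **At `x = x_c` the half-space word mass of width `≤ h` is at most `2^h`**: in the product bound every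
factor is `1 + B_{a,N}(x_c) ≤ 2` by Kesten's span-renewal inequality `B_{a,N}(x_c) ≤ 1`
(`StripMass.bridgeWordMass_le_one`, Madras–Slade (4.2.9)–(4.2.12)). This is the hypothesis of H6.
[cite: MadrasSlade1993, §3.1 and §4.2] -/
theorem halfSpaceWordMass_le_two_pow : ∀ N h : ℕ, (∑ w ∈ (Finset.range (N + 1)).biUnion (fun n => (sawWords n).filter (fun w => Zd.IsHalfSpace w.length (traj w) ∧ Zd.maxLevel w.length (traj w) ≤ (h : ℤ))), criticalFugacity ^ w.length) ≤ 2 ^ h := by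
  intro N h
  have hxc : 0 ≤ criticalFugacity := StripMass.criticalFugacity_pos.le
  refine (hw_product criticalFugacity hxc N h).trans ?_
  calc ∏ a ∈ Finset.Icc 1 h, (1 + ∑ w ∈ (Finset.range (N + 1)).biUnion
            (fun n => (sawWords n).filter (fun w => IsBridgeW w ∧ xEnd w = (a : ℤ))),
            criticalFugacity ^ w.length)
      ≤ ∏ _a ∈ Finset.Icc 1 h, (2 : ℝ) := by
        refine Finset.prod_le_prod (fun a _ => ?_) (fun a _ => ?_)
        · exact add_nonneg zero_le_one (Finset.sum_nonneg fun w _ => pow_nonneg hxc _)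
        · have h1 := StripMass.bridgeWordMass_le_one (a : ℤ) N
          linarith
    _ = 2 ^ h := by
        rw [Finset.prod_const, Nat.card_Icc, Nat.add_sub_cancel]

/-! ## Divergence of the bridge series at `x_c` (H3, H4) -/

/-- **The bridge generating function is unbounded as `x ↑ x_c`** (Madras–Slade Cor. 3.1.8, word model),
unconditional: for every `M` there are `0 < x < x_c` and `N` with `Σ_{bridge SAW words, |w| ≤ N} x^{|w|} ≥ M`.
`bridgeWordSeries_unbounded` applied to `hw_product`. [cite: MadrasSlade1993, Corollary 3.1.8] -/
theorem bridgeWordSeries_unbounded_holds : ∀ M : ℝ, ∃ x : ℝ, 0 < x ∧ x < criticalFugacity ∧ ∃ N : ℕ, M ≤ ∑ w ∈ (Finset.range (N + 1)).biUnion (fun n => (sawWords n).filter (fun w => IsBridgeW w)), x ^ w.length :=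
  bridgeWordSeries_unbounded hw_product

/-- **`Σ_n b_n x_c^n = ∞`**: the bridge generating function of `ℤ²` DIVERGES AT the critical fugacity
(`b_n = Zd.bridgeCount 2 n`; its radius is `x_c` by `SAWBridgeRadius.lean`, and at the radius it is infinite).
[cite: MadrasSlade1993, Corollary 3.1.8] -/
theorem bridgeSeries_criticalFugacity_eq_top : (∑' n : ℕ, (Zd.bridgeCount 2 n : ℝ≥0∞) * ENNReal.ofReal (criticalFugacity ^ n)) = ⊤ :=
  (bridgeSeries_eq_top_of_unbounded bridgeWordSeries_unbounded_holds).1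

/-- **`Σ_h u_h = ∞`**: the critical span-renewal densities `u_h = columnMass h` (each `≤ 1`, Kesten) have
infinite sum — Kesten's renewal walk renews at infinitely many levels in mass. For the line's bookkeeping:
no decay `u_h ≤ C (h+1)^{-b}` with `b > 1` is possible. [cite: MadrasSlade1993, §4.2] -/
theorem tsum_columnMass_eq_top : (∑' h : ℕ, columnMass h) = ⊤ :=
  (bridgeSeries_eq_top_of_unbounded bridgeWordSeries_unbounded_holds).2

/-- **No summable decay of the renewal densities**: there are no `C` and `b > 1` with
`u_h ≤ C (h+1)^{-b}` for all `h` (the `p`-series would make `Σ_h u_h` finite, against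
`tsum_columnMass_eq_top`). Calibration of the line's trade-off bookkeeping
`Cut.bubble_ne_top_of_exponents` (gain `a`, decay `b`, growth `c`, `a + b − c > 1`): the decay slot of `u_h`
can never carry more than `b ≤ 1` (conjecturally `b = 1/4`). [cite: MadrasSlade1993, §4.2] -/
theorem not_columnMass_decay : ¬ ∃ (C : ℝ≥0) (b : ℝ), 1 < b ∧ ∀ h : ℕ, columnMass h ≤ (C : ℝ≥0∞) * ENNReal.ofReal (((h : ℝ) + 1) ^ (-b)) := by
  rintro ⟨C, b, hb, hle⟩
  have hsum : Summable fun n : ℕ => ((n : ℝ) + 1) ^ (-b) := by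
    have h1 : Summable fun n : ℕ => (n : ℝ) ^ (-b) := Real.summable_nat_rpow.2 (by linarith)
    simpa using (summable_nat_add_iff 1).2 h1
  have hfin : (∑' h : ℕ, columnMass h) ≠ ⊤ := by
    refine ne_top_of_le_ne_top ?_ (ENNReal.tsum_le_tsum hle)
    rw [ENNReal.tsum_mul_left]
    refine ENNReal.mul_ne_top ENNReal.coe_ne_top ?_
    rw [← ENNReal.ofReal_tsum_of_nonneg (fun n => Real.rpow_nonneg (by positivity) _) hsum]
    exact ENNReal.ofReal_ne_top
  exact hfin tsum_columnMass_eq_top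

/-! ## Kesten's criticality identity (H5) -/

/-- **Kesten's identity** (Kesten 1963, §4; Madras–Slade (4.2.4) with Corollary 3.1.8): the critical masses
of the irreducible bridges of `ℤ²` sum to exactly one, `Σ_{β irreducible bridge} x_c^{|β|} = 1` — the law of
Kesten's renewal measure is a probability law. Word model (`IsIrrBridge` of `SAWWordBridges.lean`); this is
verbatim the statement of the support item `KestenIdentity` of route `SAWRenewalTightness`.
`kestenIdentity_of_unbounded` applied to `bridgeWordSeries_unbounded_holds`.
[cite: Kesten1963SAW, §4] [cite: MadrasSlade1993, §4.2, eq. (4.2.4)] -/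
theorem kestenIdentity : HasSum (fun w : {w : List Literature.Probability.RandomPlanarGeometry.SAW.Step // Literature.Probability.RandomPlanarGeometry.SAW.IsIrrBridge w} => Literature.Probability.RandomPlanarGeometry.SAW.criticalFugacity ^ w.1.length) 1 :=
  kestenIdentity_of_unbounded bridgeWordSeries_unbounded_holds

/-- The `tsum` form of Kesten's identity: `∑' β, x_c^{|β|} = 1` over the irreducible bridges.
[cite: MadrasSlade1993, §4.2, eq. (4.2.4)] -/
theorem tsum_irrBridge_criticalFugacity_pow : (∑' w : {w : List Step // IsIrrBridge w}, criticalFugacity ^ w.1.length) = 1 :=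
  kestenIdentity.tsum_eq

/-! ## The effective floor under stub B1 (H6, H7) -/

/-- **`Λ^w_N(h) ≤ 2μ·4^h`** (word model, unconditional): the length-weighted critical mass of the self-avoiding
bridge words of span `h` and length `≤ N` is at most `2μ·4^h`, uniformly in `N`. `spanLengthWordMass_le`
applied to `halfSpaceWordMass_le_two_pow`. [cite: MadrasSlade1993, §3.1 and §4.2] -/
theorem spanLengthWordMass_le_exp : ∀ N h : ℕ, (∑ w ∈ (Finset.range (N + 1)).biUnion (fun n => (sawWords n).filter (fun w => IsBridgeW w ∧ xEnd w = (h : ℤ))), (w.length : ℝ) * criticalFugacity ^ w.length) ≤ 2 * connectiveConstant * 4 ^ h :=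
  spanLengthWordMass_le halfSpaceWordMass_le_two_pow

/-- **`Λ_h ≤ 2μ·4^h`** in the line's objects: the length-weighted critical mass of the bridges of `ℤ²` of span
`h` (`Σ_{span W = h} |W| x_c^{|W|} = x_c B_h'(x_c)`) is at most `2μ·4^h` — an EFFECTIVE constant (c3's
`Strip.spanLengthMass_lt_top` gave finiteness only). [cite: MadrasSlade1993, §3.1 and §4.2] -/
theorem spanLengthMass_le_exp : ∀ h : ℕ, (∑' W : Bridge, if W.span = (h : ℤ) then (W.len : ℝ≥0∞) * W.mass else 0) ≤ ENNReal.ofReal (2 * connectiveConstant * 4 ^ h) :=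
  (pinnedLengthMass_le_exp_of spanLengthWordMass_le_exp).1

/-- **Effective floor under stub B1**: `sup_{v : v₀ = h} L(v) ≤ 2μ·4^h` — the pinned length-weighted critical
bridge mass is bounded along each column by an explicit exponential in the column (the open stub
`Kesten.PinnedLengthMassBound (1/5)` asks for `C (h+1)^{1/5}` instead). [cite: MadrasSlade1993, §3.1 and §4.2] -/
theorem pinnedLengthMass_le_exp : ∀ (h : ℕ) (v : Site 2), v 0 = (h : ℤ) → pinnedLengthMass v ≤ ENNReal.ofReal (2 * connectiveConstant * 4 ^ h) :=
  (pinnedLengthMass_le_exp_of spanLengthWordMass_le_exp).2.1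

/-- **`F(h) ≤ 4μ·4^h`**: the free length-weighted apex-pinned pair mass of the line is bounded by an explicit
exponential in the column (Fubini step `Cut.freePairMass_le`, Kesten's `u_h ≤ 1`, and `pinnedLengthMass_le_exp`).
[cite: MadrasSlade1993, §3.1 and §4.2] -/
theorem freePairMass_le_exp : ∀ h : ℕ, freePairMass h ≤ 2 * ENNReal.ofReal (2 * connectiveConstant * 4 ^ h) :=
  (pinnedLengthMass_le_exp_of spanLengthWordMass_le_exp).2.2

end Summit.CriticalPhenomena.SAWScalingLimit.Theorems.CriticalBubbleBound.Kesten.HW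

end
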